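import Summits.KontsevichZagierPeriods.KontsevichZagierPeriods.Theorems.SymplecticScissorsPlanarCompilerStubSignedSweepAux
import Summits.KontsevichZagierPeriods.KontsevichZagierPeriods.Theorems.SymplecticScissorsPlanarCompilerStubSignedSweepAux2
import Summits.KontsevichZagierPeriods.KontsevichZagierPeriods.Theorems.SymplecticScissorsPlanarCompilerStubSignedSweepAux3
import Summits.KontsevichZagierPeriods.KontsevichZagierPeriods.Theorems.SymplecticScissorsPlanarCompilerStubSignedSweepAux5
import Summits.KontsevichZagierPeriods.KontsevichZagierPeriods.Theorems.SymplecticScissorsPlanarCompilerStubSignedSweepAux8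
import Literature.NumberTheory.Transcendental.KZSemialgebraicComplex

/-!
# `PlanarCompiler`, line `twist-restoring-shear`: stub `stub_signedSweep`

The signed vertical sweep of the open triangle `T` for a Green datum `(A, B, S)` (`A, B`
`ℚ`-semialgebraic and continuous on the closed triangle `Δ`, `dS = A da + B db` on `T`): a
cylindrical decomposition of `T` into strips and stacked open cells with continuous monotone
`ℚ`-semialgebraic graph functions, each cell inside the common `C¹`-locus of `A, B` where
`∂_b A = ∂_a B` (Clairaut from the potential), carrying the constant sign `ε ∈ {1, -1, 0}` of
`∂_b A`, with both sheared projections `p ↦ (p 0, A p)`, `p ↦ (p 1, B p)` injective on the signed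
cells, together with the trace representations along the graphs and the integrand-`1`
representations on the sheared images.

First the flat sweep for abstract `ℚ`-semialgebraic `W, P, N` (`stub_signedSweep_flatSweep`):
over each strip of `stub_signedSweep_strips` the sweep of one strip (`stub_signedSweep_stripSweep`)
gives the levels; strips and levels are re-indexed by a single finite type `Fin m`
(`finSigmaFinEquiv`), the cells are pairwise disjoint, and the open triangle is covered by the
cells up to a null set (the verticals over the breakpoints and, over each strip, the graphs).
Then the assembly: the smooth locus (`stub_signedSweep_smoothLocus`) and the sign sets of `∂_b A`
as `W, P, N`, injectivity by the mean value theorem (`stub_signedSweep_injOnShear`,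
`injOn_shear_snd`), and the representations (`stub_signedSweep_traceRep`, `exists_imageRep`).
-/

noncomputable section

open MeasureTheory Set
open Literature.NumberTheory.Transcendental Literature.ModelTheory.ExponentialFields
open Summit.KontsevichZagierPeriods.KontsevichZagierPeriods.Theses.SymplecticScissors

namespace Summit.KontsevichZagierPeriods.SymplecticScissors.PlanarCompilerProof

/-- **The flat sweep.** For `ℚ`-semialgebraic `W, P, N` with `T ∖ W` null there are strips
`(x_j, x_{j+1})` (`x` strictly increasing from `0` to `1`) and finitely many cells `C i`, the cell
`i` lying over the strip `str i` at level `lev i < L (str i)` between the graphs of `lo i < hi i`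
(continuous and monotone or antitone on the closed strip, `ℚ`-semialgebraic on the open strip,
`lo = 0` at the bottom, `hi = 1 - t` at the top, consecutive levels sharing their graph), the cells
being open, `ℚ`-semialgebraic, inside `T` and `W`, pairwise disjoint, covering `T` up to a null
set, and each cell lying in `P`, in `N`, or missing both. [folklore] -/
theorem stub_signedSweep_flatSweep :
    ∀ {W P N : Set (Fin 2 → ℝ)}, IsSemialgebraic ℚ W → IsSemialgebraic ℚ P → IsSemialgebraic ℚ N →
    volume ({p : Fin 2 → ℝ | 0 < p 0 ∧ 0 < p 1 ∧ p 0 + p 1 < 1} \ W) = 0 →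
    ∃ (k : ℕ) (x : Fin (k + 1) → ℝ) (m : ℕ) (str : Fin m → Fin k) (lev : Fin m → ℕ) (L : Fin k → ℕ)
      (lo hi : Fin m → ℝ → ℝ) (C : Fin m → Set (Fin 2 → ℝ)),
      StrictMono x ∧ x 0 = 0 ∧ x (Fin.last k) = 1 ∧ (∀ i, lev i < L (str i)) ∧
      (∀ i j, str i = str j → lev i = lev j → i = j) ∧
      (∀ (j : Fin k) (l : ℕ), l < L j → ∃ i, str i = j ∧ lev i = l) ∧ (∀ j, 0 < L j) ∧
      (∀ i, lev i = 0 → ∀ t ∈ Icc (x (Fin.castSucc (str i))) (x (Fin.succ (str i))), lo i t = 0) ∧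
      (∀ i, lev i + 1 = L (str i) → ∀ t ∈ Icc (x (Fin.castSucc (str i))) (x (Fin.succ (str i))), hi i t = 1 - t) ∧
      (∀ i j, str i = str j → lev j = lev i + 1 →
        ∀ t ∈ Icc (x (Fin.castSucc (str i))) (x (Fin.succ (str i))), lo j t = hi i t) ∧
      (∀ i, ContinuousOn (lo i) (Icc (x (Fin.castSucc (str i))) (x (Fin.succ (str i))))) ∧
      (∀ i, ContinuousOn (hi i) (Icc (x (Fin.castSucc (str i))) (x (Fin.succ (str i))))) ∧
      (∀ i, MonotoneOn (lo i) (Icc (x (Fin.castSucc (str i))) (x (Fin.succ (str i)))) ∨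
        AntitoneOn (lo i) (Icc (x (Fin.castSucc (str i))) (x (Fin.succ (str i))))) ∧
      (∀ i, MonotoneOn (hi i) (Icc (x (Fin.castSucc (str i))) (x (Fin.succ (str i)))) ∨
        AntitoneOn (hi i) (Icc (x (Fin.castSucc (str i))) (x (Fin.succ (str i))))) ∧
      (∀ i, ∀ t ∈ Ioo (x (Fin.castSucc (str i))) (x (Fin.succ (str i))), lo i t < hi i t) ∧
      (∀ i, IsSemialgebraicFunOn ℚ {z : Fin 1 → ℝ | z 0 ∈ Ioo (x (Fin.castSucc (str i))) (x (Fin.succ (str i)))}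
        (fun z => lo i (z 0))) ∧
      (∀ i, IsSemialgebraicFunOn ℚ {z : Fin 1 → ℝ | z 0 ∈ Ioo (x (Fin.castSucc (str i))) (x (Fin.succ (str i)))}
        (fun z => hi i (z 0))) ∧
      (∀ i, C i = {p : Fin 2 → ℝ | p 0 ∈ Ioo (x (Fin.castSucc (str i))) (x (Fin.succ (str i))) ∧
        lo i (p 0) < p 1 ∧ p 1 < hi i (p 0)}) ∧
      (∀ i, IsOpen (C i)) ∧ (∀ i, IsSemialgebraic ℚ (C i)) ∧
      (∀ i, C i ⊆ {p : Fin 2 → ℝ | 0 < p 0 ∧ 0 < p 1 ∧ p 0 + p 1 < 1}) ∧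
      (Pairwise fun i j => Disjoint (C i) (C j)) ∧
      volume ({p : Fin 2 → ℝ | 0 < p 0 ∧ 0 < p 1 ∧ p 0 + p 1 < 1} \ ⋃ i, C i) = 0 ∧
      (∀ i, C i ⊆ W) ∧
      (∀ i, C i ⊆ P ∨ C i ⊆ N ∨ (Disjoint (C i) P ∧ Disjoint (C i) N)) := by
  intro W P N hWsa hPsa hNsa hnull
  obtain ⟨k, x, hxmono, hx0, hxl, hcov, hper⟩ := stub_signedSweep_strips hWsa hPsa hNsa
  -- the sweep of each strip
  have hper' : ∀ s : Fin k, ∃ (L : ℕ) (bnd : ℕ → ℝ → ℝ), 0 < L ∧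
      (∀ t ∈ Icc (x (Fin.castSucc s)) (x (Fin.succ s)), bnd 0 t = 0) ∧
      (∀ t ∈ Icc (x (Fin.castSucc s)) (x (Fin.succ s)), bnd L t = 1 - t) ∧
      (∀ l, l ≤ L → ContinuousOn (bnd l) (Icc (x (Fin.castSucc s)) (x (Fin.succ s)))) ∧
      (∀ l, l ≤ L → (MonotoneOn (bnd l) (Icc (x (Fin.castSucc s)) (x (Fin.succ s))) ∨
        AntitoneOn (bnd l) (Icc (x (Fin.castSucc s)) (x (Fin.succ s))))) ∧
      (∀ l, l < L → ∀ t ∈ Ioo (x (Fin.castSucc s)) (x (Fin.succ s)), bnd l t < bnd (l + 1) t) ∧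
      (∀ l, l ≤ L → IsSemialgebraicFunOn ℚ {z : Fin 1 → ℝ | z 0 ∈ Ioo (x (Fin.castSucc s)) (x (Fin.succ s))}
        (fun z => bnd l (z 0))) ∧
      (∀ l, l < L → IsOpen {p : Fin 2 → ℝ | p 0 ∈ Ioo (x (Fin.castSucc s)) (x (Fin.succ s)) ∧
        bnd l (p 0) < p 1 ∧ p 1 < bnd (l + 1) (p 0)}) ∧
      (∀ l, l < L → IsSemialgebraic ℚ {p : Fin 2 → ℝ | p 0 ∈ Ioo (x (Fin.castSucc s)) (x (Fin.succ s)) ∧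
        bnd l (p 0) < p 1 ∧ p 1 < bnd (l + 1) (p 0)}) ∧
      (∀ l, l < L → {p : Fin 2 → ℝ | p 0 ∈ Ioo (x (Fin.castSucc s)) (x (Fin.succ s)) ∧
        bnd l (p 0) < p 1 ∧ p 1 < bnd (l + 1) (p 0)} ⊆ {p : Fin 2 → ℝ | 0 < p 0 ∧ 0 < p 1 ∧ p 0 + p 1 < 1}) ∧
      (∀ l, l < L → {p : Fin 2 → ℝ | p 0 ∈ Ioo (x (Fin.castSucc s)) (x (Fin.succ s)) ∧
        bnd l (p 0) < p 1 ∧ p 1 < bnd (l + 1) (p 0)} ⊆ W) ∧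
      (∀ l, l < L →
        ({p : Fin 2 → ℝ | p 0 ∈ Ioo (x (Fin.castSucc s)) (x (Fin.succ s)) ∧
          bnd l (p 0) < p 1 ∧ p 1 < bnd (l + 1) (p 0)} ⊆ P ∨
         {p : Fin 2 → ℝ | p 0 ∈ Ioo (x (Fin.castSucc s)) (x (Fin.succ s)) ∧
          bnd l (p 0) < p 1 ∧ p 1 < bnd (l + 1) (p 0)} ⊆ N ∨
         (Disjoint {p : Fin 2 → ℝ | p 0 ∈ Ioo (x (Fin.castSucc s)) (x (Fin.succ s)) ∧
            bnd l (p 0) < p 1 ∧ p 1 < bnd (l + 1) (p 0)} P ∧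
          Disjoint {p : Fin 2 → ℝ | p 0 ∈ Ioo (x (Fin.castSucc s)) (x (Fin.succ s)) ∧
            bnd l (p 0) < p 1 ∧ p 1 < bnd (l + 1) (p 0)} N))) ∧
      volume ({p : Fin 2 → ℝ | p 0 ∈ Ioo (x (Fin.castSucc s)) (x (Fin.succ s)) ∧ 0 < p 1 ∧ p 0 + p 1 < 1} \
        ⋃ (l : ℕ) (_ : l < L), {p : Fin 2 → ℝ | p 0 ∈ Ioo (x (Fin.castSucc s)) (x (Fin.succ s)) ∧
          bnd l (p 0) < p 1 ∧ p 1 < bnd (l + 1) (p 0)}) = 0 := by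
    intro s
    obtain ⟨n, ξ, hcont, hsa, hmono, hshape, hpart, hTb, hTg, hWb, hPb, hNb⟩ := hper s
    have hu : 0 ≤ x (Fin.castSucc s) := by rw [← hx0]; exact hxmono.monotone (Fin.zero_le _)
    have hv : x (Fin.succ s) ≤ 1 := by rw [← hxl]; exact hxmono.monotone (Fin.le_last _)
    exact stub_signedSweep_stripSweep hu (hxmono Fin.castSucc_lt_succ) hv hcont hsa hmono hshape hpart hTb hTg hWb
      hPb hNb hnull
  choose L bnd hLpos hb0 hbL hbc hbm hblt hbsa hbo hbsa2 hbT hbW hbPN hbnull using hper'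
  -- levels are increasing on the open strip
  have hbmono : ∀ (s : Fin k) (a b : ℕ), a ≤ b → b ≤ L s →
      ∀ t ∈ Ioo (x (Fin.castSucc s)) (x (Fin.succ s)), bnd s a t ≤ bnd s b t := by
    intro s a b hab hbL' t ht
    induction b, hab using Nat.le_induction with
    | base => exact le_rfl
    | succ b hab ih => exact (ih (Nat.le_of_succ_le hbL')).trans (hblt s b hbL' t ht).le
  -- distinct strips are disjoint
  have hstrips : ∀ s s' : Fin k, s < s' → ∀ t : ℝ, t ∈ Ioo (x (Fin.castSucc s)) (x (Fin.succ s)) →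
      t ∉ Ioo (x (Fin.castSucc s')) (x (Fin.succ s')) := by
    intro s s' hss' t ht ht'
    have hle : x (Fin.succ s) ≤ x (Fin.castSucc s') := by
      refine hxmono.monotone (Fin.le_def.2 ?_)
      rw [Fin.val_succ, Fin.val_castSucc]
      exact Fin.lt_def.1 hss'
    exact absurd (ht.2.trans_le (hle.trans ht'.1.le)) (lt_irrefl _)
  -- flattening of the index set
  obtain ⟨e⟩ : Nonempty ((Σ s : Fin k, Fin (L s)) ≃ Fin (∑ s, L s)) := ⟨finSigmaFinEquiv⟩
  set m : ℕ := ∑ s, L s with hm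
  set str : Fin m → Fin k := fun i => (e.symm i).1 with hstr_def
  set lev : Fin m → ℕ := fun i => ((e.symm i).2 : ℕ) with hlev_def
  have hlevlt : ∀ i, lev i < L (str i) := fun i => (e.symm i).2.isLt
  have hinj : ∀ i j, str i = str j → lev i = lev j → i = j := by
    intro i j h1 h2
    apply e.symm.injective
    exact Sigma.ext h1 ((Fin.heq_ext_iff (congrArg L h1)).2 h2)
  have hsurj : ∀ (j : Fin k) (l : ℕ), l < L j → ∃ i, str i = j ∧ lev i = l := by
    intro j l hl
    refine ⟨e ⟨j, ⟨l, hl⟩⟩, ?_, ?_⟩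
    · show (e.symm (e ⟨j, ⟨l, hl⟩⟩)).1 = j
      rw [Equiv.symm_apply_apply]
    · show ((e.symm (e ⟨j, ⟨l, hl⟩⟩)).2 : ℕ) = l
      rw [Equiv.symm_apply_apply]
  refine ⟨k, x, m, str, lev, L, fun i => bnd (str i) (lev i), fun i => bnd (str i) (lev i + 1),
    fun i => {p : Fin 2 → ℝ | p 0 ∈ Ioo (x (Fin.castSucc (str i))) (x (Fin.succ (str i))) ∧
      bnd (str i) (lev i) (p 0) < p 1 ∧ p 1 < bnd (str i) (lev i + 1) (p 0)},
    hxmono, hx0, hxl, hlevlt, hinj, hsurj, hLpos, ?_, ?_, ?_,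
    fun i => hbc _ _ (hlevlt i).le, fun i => hbc _ _ (hlevlt i),
    fun i => hbm _ _ (hlevlt i).le, fun i => hbm _ _ (hlevlt i),
    fun i => hblt _ _ (hlevlt i),
    fun i => hbsa _ _ (hlevlt i).le, fun i => hbsa _ _ (hlevlt i),
    fun i => rfl, fun i => hbo _ _ (hlevlt i), fun i => hbsa2 _ _ (hlevlt i),
    fun i => hbT _ _ (hlevlt i), ?_, ?_, fun i => hbW _ _ (hlevlt i),
    fun i => hbPN _ _ (hlevlt i)⟩
  · -- `lo = 0` at the bottom
    intro i hi t ht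
    simp only [hi]
    exact hb0 _ t ht
  · -- `hi = 1 - t` at the top
    intro i hi t ht
    simp only [hi]
    exact hbL _ t ht
  · -- consecutive levels share their graph
    intro i j hstr hlev t _
    simp only [hlev, hstr]
  · -- pairwise disjoint cells
    intro i j hij
    rw [Set.disjoint_left]
    intro p hpi hpj
    simp only [mem_setOf_eq] at hpi hpj
    apply hij
    have h1 : str i = str j := by
      by_contra hne
      rcases lt_or_gt_of_ne hne with h | h
      · exact hstrips _ _ h (p 0) hpi.1 hpj.1
      · exact hstrips _ _ h (p 0) hpj.1 hpi.1
    refine hinj i j h1 ?_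
    by_contra hne
    -- same strip, different levels
    have hlj : lev j < L (str i) := by rw [h1]; exact hlevlt j
    rw [← h1] at hpj
    rcases lt_or_gt_of_ne hne with h | h
    · have hle := hbmono (str i) (lev i + 1) (lev j) h hlj.le (p 0) hpi.1
      exact absurd (hpi.2.2.trans_le (hle.trans hpj.2.1.le)) (lt_irrefl _)
    · have hle := hbmono (str i) (lev j + 1) (lev i) h (hlevlt i).le (p 0) hpi.1
      exact absurd (hpj.2.2.trans_le (hle.trans hpi.2.1.le)) (lt_irrefl _)
  · -- the cells cover `T` up to a null set
    have hsub : ({p : Fin 2 → ℝ | 0 < p 0 ∧ 0 < p 1 ∧ p 0 + p 1 < 1} \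
        ⋃ i : Fin m, {p : Fin 2 → ℝ | p 0 ∈ Ioo (x (Fin.castSucc (str i))) (x (Fin.succ (str i))) ∧
          bnd (str i) (lev i) (p 0) < p 1 ∧ p 1 < bnd (str i) (lev i + 1) (p 0)}) ⊆
        (⋃ i' : Fin (k + 1), {p : Fin 2 → ℝ | Fin.init p ∈ {w : Fin 1 → ℝ | w (Fin.last 0) = x i'}}) ∪
        ⋃ s : Fin k, ({p : Fin 2 → ℝ | p 0 ∈ Ioo (x (Fin.castSucc s)) (x (Fin.succ s)) ∧ 0 < p 1 ∧ p 0 + p 1 < 1} \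
          ⋃ (l : ℕ) (_ : l < L s), {p : Fin 2 → ℝ | p 0 ∈ Ioo (x (Fin.castSucc s)) (x (Fin.succ s)) ∧
            bnd s l (p 0) < p 1 ∧ p 1 < bnd s (l + 1) (p 0)}) := by
      rintro p ⟨⟨hp0, hp1, hp2⟩, hnot⟩
      have hpI : p 0 ∈ Icc (0 : ℝ) 1 := ⟨hp0.le, by linarith⟩
      rcases hcov (p 0) hpI with ⟨i', hi'⟩ | ⟨s, hs⟩
      · exact Or.inl (mem_iUnion.2 ⟨i', hi'.symm⟩)
      · refine Or.inr (mem_iUnion.2 ⟨s, ⟨hs, hp1, hp2⟩, fun hmem => hnot ?_⟩)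
        obtain ⟨l, hl⟩ := mem_iUnion.1 hmem
        obtain ⟨hlL, hpl⟩ := mem_iUnion.1 hl
        obtain ⟨i, hi1, hi2⟩ := hsurj s l hlL
        refine mem_iUnion.2 ⟨i, ?_⟩
        rw [hi1, hi2]
        exact hpl
    refine measure_mono_null hsub (measure_union_null (measure_iUnion_null fun i' => ?_)
      (measure_iUnion_null fun s => hbnull s))
    exact KZ.volume_setOf_init_mem_eq_zero (KZ.volume_setOf_last_eq_zero (n := 0) (x i'))

/-- The two graphs bounding a cell of the sweep over an open strip inside `(0, 1)` lie in the
closed triangle when the cell lies in the open triangle. [folklore] -/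
theorem trace_mem_closedTriangle {lo hi : ℝ → ℝ} {u v : ℝ} (hu : 0 ≤ u)
    (hlt : ∀ t ∈ Ioo u v, lo t < hi t)
    (hT : {p : Fin 2 → ℝ | p 0 ∈ Ioo u v ∧ lo (p 0) < p 1 ∧ p 1 < hi (p 0)} ⊆
      {p : Fin 2 → ℝ | 0 < p 0 ∧ 0 < p 1 ∧ p 0 + p 1 < 1}) :
    ∀ t ∈ Ioo u v, (![t, lo t] : Fin 2 → ℝ) ∈ {p : Fin 2 → ℝ | 0 ≤ p 0 ∧ 0 ≤ p 1 ∧ p 0 + p 1 ≤ 1} ∧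
      (![t, hi t] : Fin 2 → ℝ) ∈ {p : Fin 2 → ℝ | 0 ≤ p 0 ∧ 0 ≤ p 1 ∧ p 0 + p 1 ≤ 1} := by
  intro t ht
  have ht0 : 0 ≤ t := hu.trans ht.1.le
  have hlh := hlt t ht
  have hin : ∀ y : ℝ, lo t < y → y < hi t → 0 < y ∧ t + y < 1 := by
    intro y h1 h2
    have hmem : (![t, y] : Fin 2 → ℝ) ∈ {p : Fin 2 → ℝ | p 0 ∈ Ioo u v ∧ lo (p 0) < p 1 ∧ p 1 < hi (p 0)} :=
      ⟨ht, h1, h2⟩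
    have := hT hmem
    exact ⟨this.2.1, this.2.2⟩
  have hlo : 0 ≤ lo t := by
    by_contra hneg
    rw [not_le] at hneg
    have hm : lo t < min 0 (hi t) := lt_min hneg hlh
    have h := hin ((lo t + min 0 (hi t)) / 2) (by linarith) (by have := min_le_right 0 (hi t); linarith)
    have := min_le_left 0 (hi t)
    linarith [h.1]
  have hhi : hi t ≤ 1 - t := by
    by_contra hgt
    rw [not_le] at hgt
    have hm : max (lo t) (1 - t) < hi t := max_lt hlh hgt
    have h := hin ((max (lo t) (1 - t) + hi t) / 2) (by have := le_max_left (lo t) (1 - t); linarith)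
      (by linarith)
    have := le_max_right (lo t) (1 - t)
    linarith [h.2]
  refine ⟨⟨?_, ?_, ?_⟩, ?_, ?_, ?_⟩
  · show 0 ≤ t; exact ht0
  · show 0 ≤ lo t; exact hlo
  · show t + lo t ≤ 1; linarith
  · show 0 ≤ t; exact ht0
  · show 0 ≤ hi t; linarith
  · show t + hi t ≤ 1; linarith

/-- **Stub 5 (L).** The signed vertical sweep of the open triangle: a cylindrical decomposition into strips `(x_j, x_{j+1})` and stacked cells `{lo < b < hi}` with continuous, monotone, `ℚ`-semialgebraic graph functions (`lo = 0` at the bottom, `hi = 1 − a` at the top, consecutive cells share their graph), each cell inside the common `C¹`-locus of `A, B` (generic smoothness), carrying the constant sign `ε ∈ {1, −1, 0}` of `∂_bA` (`= ∂_aB`, Clairaut from the potential `S`), with both sheared projections injective on the signed cells (bi-convexity + strict fibre monotonicity), together with the trace representations `[∫ A(t, lo t) dt]`, `[∫ A(t, hi t) dt]` and the integrand-`1` representations on `Ψ₁(C)`, `Ψ₂(C)`. Pure semialgebraic geometry: no `Θ`. -/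
theorem stub_signedSweep :
    ∀ (A B S : (Fin 2 → ℝ) → ℝ), IsSemialgebraicFunOn ℚ {p : Fin 2 → ℝ | 0 ≤ p 0 ∧ 0 ≤ p 1 ∧ p 0 + p 1 ≤ 1} A → IsSemialgebraicFunOn ℚ {p : Fin 2 → ℝ | 0 ≤ p 0 ∧ 0 ≤ p 1 ∧ p 0 + p 1 ≤ 1} B → ContinuousOn A {p : Fin 2 → ℝ | 0 ≤ p 0 ∧ 0 ≤ p 1 ∧ p 0 + p 1 ≤ 1} → ContinuousOn B {p : Fin 2 → ℝ | 0 ≤ p 0 ∧ 0 ≤ p 1 ∧ p 0 + p 1 ≤ 1} → (∀ p : Fin 2 → ℝ, 0 < p 0 → 0 < p 1 → p 0 + p 1 < 1 → HasFDerivAt S (A p • (ContinuousLinearMap.proj 0 : (Fin 2 → ℝ) →L[ℝ] ℝ) + B p • (ContinuousLinearMap.proj 1 : (Fin 2 → ℝ) →L[ℝ] ℝ)) p) → ∃ (k : ℕ) (x : Fin (k + 1) → ℝ) (m : ℕ) (str : Fin m → Fin k) (lev : Fin m → ℕ) (L : Fin k → ℕ) (lo hi : Fin m → ℝ → ℝ)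 (ε : Fin m → ℤ) (C : Fin m → Set (Fin 2 → ℝ)) (ρlo ρhi : Fin m → KZ.IntegralRep 1) (r₁ r₂ : Fin m → KZ.IntegralRep 2), StrictMono x ∧ x 0 = 0 ∧ x (Fin.last k) = 1 ∧ (∀ i, lev i < L (str i)) ∧ (∀ i j, str i = str j → lev i = lev j → i = j) ∧ (∀ (j : Fin k) (l : ℕ), l < L j → ∃ i, str i = j ∧ lev i = l) ∧ (∀ j, 0 < L j) ∧ (∀ i, lev i = 0 → ∀ t ∈ (Set.Icc (x (Fin.castSucc (str i))) (x (Fin.succ (str i)))), lo i t = 0) ∧ (∀ i, lev i + 1 = L (str i) → ∀ t ∈ (Set.Icc (x (Fin.castSucc (str i))) (x (Fin.succ (str i)))), hi i t = 1 - t) ∧ (∀ i j, str i = str j → lev j = lev i + 1 → ∀ t ∈ (Set.Icc (x (Fin.castSucc (str i))) (x (Fin.succ (str i)))), lo j t = hi i t) ∧ (∀ i, ContinuousOn (lo i) (Set.Icc (x (Fin.castSucc (str i))) (x (Fin.succ (str i))))) ∧ (∀ i, ContinuousOn (hi i) (Set.Icc (x (Fin.castSucc (str i))) (x (Fin.succ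 (str i))))) ∧ (∀ i, MonotoneOn (lo i) (Set.Icc (x (Fin.castSucc (str i))) (x (Fin.succ (str i)))) ∨ AntitoneOn (lo i) (Set.Icc (x (Fin.castSucc (str i))) (x (Fin.succ (str i))))) ∧ (∀ i, MonotoneOn (hi i) (Set.Icc (x (Fin.castSucc (str i))) (x (Fin.succ (str i)))) ∨ AntitoneOn (hi i) (Set.Icc (x (Fin.castSucc (str i))) (x (Fin.succ (str i))))) ∧ (∀ i, ∀ t ∈ (Set.Ioo (x (Fin.castSucc (str i))) (x (Fin.succ (str i)))), lo i t < hi i t) ∧ (∀ i, IsSemialgebraicFunOn ℚ {z : Fin 1 → ℝ | z 0 ∈ Set.Ioo (x (Fin.castSucc (str i))) (x (Fin.succ (str i)))} (fun z => lo i (z 0))) ∧ (∀ i, IsSemialgebraicFunOn ℚ {z : Fin 1 → ℝ | z 0 ∈ Set.Ioo (x (Fin.castSucc (str i))) (x (Fin.succ (str i)))} (fun z => hi i (z 0))) ∧ (∀ i, C i = {p : Fin 2 → ℝ | p 0 ∈ (Set.Ioo (x (Fin.castSucc (str i))) (x (Fin.succ (str i)))) ∧ lo i (p 0) < p 1 ∧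 p 1 < hi i (p 0)}) ∧ (∀ i, IsOpen (C i)) ∧ (∀ i, IsSemialgebraic ℚ (C i)) ∧ (∀ i, C i ⊆ {p : Fin 2 → ℝ | 0 < p 0 ∧ 0 < p 1 ∧ p 0 + p 1 < 1}) ∧ (Pairwise fun i j => Disjoint (C i) (C j)) ∧ MeasureTheory.volume ({p : Fin 2 → ℝ | 0 < p 0 ∧ 0 < p 1 ∧ p 0 + p 1 < 1} \ ⋃ i, C i) = 0 ∧ (∀ i, ContDiffOn ℝ 1 A (C i)) ∧ (∀ i, ContDiffOn ℝ 1 B (C i)) ∧ (∀ i, ∀ p ∈ C i, fderiv ℝ A p (Pi.single 1 1) = fderiv ℝ B p (Pi.single 0 1)) ∧ (∀ i, ε i = 1 ∨ ε i = -1 ∨ ε i = 0) ∧ (∀ i, ∀ p ∈ C i, ε i ≠ 0 → 0 < (ε i : ℝ) * fderiv ℝ A p (Pi.single 1 1)) ∧ (∀ i, ∀ p ∈ C i, ε i = 0 → fderiv ℝ A p (Pi.single 1 1) = 0) ∧ (∀ i, ε i ≠ 0 → Set.InjOn (fun p : Fin 2 → ℝ => (![p 0, A p] : Fin 2 → ℝ))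 (C i)) ∧ (∀ i, ε i ≠ 0 → Set.InjOn (fun p : Fin 2 → ℝ => (![p 1, B p] : Fin 2 → ℝ)) (C i)) ∧ (∀ i, (ρlo i).domain = {z : Fin 1 → ℝ | z 0 ∈ Set.Ioo (x (Fin.castSucc (str i))) (x (Fin.succ (str i)))}) ∧ (∀ i, (ρhi i).domain = {z : Fin 1 → ℝ | z 0 ∈ Set.Ioo (x (Fin.castSucc (str i))) (x (Fin.succ (str i)))}) ∧ (∀ i, ∀ z ∈ (ρlo i).domain, (ρlo i).integrand z = A ![z 0, lo i (z 0)]) ∧ (∀ i, ∀ z ∈ (ρhi i).domain, (ρhi i).integrand z = A ![z 0, hi i (z 0)]) ∧ (∀ i, (r₁ i).domain = (fun p : Fin 2 → ℝ => (![p 0, A p] : Fin 2 → ℝ)) '' C i) ∧ (∀ i, (r₂ i).domain = (fun p : Fin 2 → ℝ => (![p 1, B p] : Fin 2 → ℝ)) '' C i) ∧ (∀ i, (r₁ i).integrand = fun _ => 1) ∧ (∀ i, (r₂ i).integrand = fun _ => 1) := by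
  classical
  intro A B S hA hB hAc hBc hS
  obtain ⟨W, hWo, hWsa, hWT, -, hnull, hA1, hB1, hClair, hAW, hBW, hh⟩ := stub_signedSweep_smoothLocus A B S hA hB hS
  -- the sign sets of `∂_b A` inside the smooth locus
  set P : Set (Fin 2 → ℝ) := {p | p ∈ W ∧ 0 < fderiv ℝ A p (Pi.single 1 1)} with hP
  set N : Set (Fin 2 → ℝ) := {p | p ∈ W ∧ fderiv ℝ A p (Pi.single 1 1) < 0} with hN
  have hPsa : IsSemialgebraic ℚ P := by
    have h := (hh.neg).isSemialgebraic_sep_neg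
    convert h using 1
    ext p
    simp only [hP, mem_setOf_eq, Pi.neg_apply, neg_lt_zero]
  have hNsa : IsSemialgebraic ℚ N := hh.isSemialgebraic_sep_neg
  obtain ⟨k, x, m, str, lev, L, lo, hi, C, hxmono, hx0, hxl, h4, h5, h6, h7, h8, h9, h10, h11, h12, h13,
    h14, h15, h16, h17, h18, h19, h20, h21, h22, h23, hCW, hCPN⟩ := stub_signedSweep_flatSweep hWsa hPsa hNsa hnull
  -- the signs
  set ε : Fin m → ℤ := fun i => if C i ⊆ P then 1 else if C i ⊆ N then -1 else 0 with hε
  have hε_cases : ∀ i, (ε i = 1 ∧ C i ⊆ P) ∨ (ε i = -1 ∧ C i ⊆ N) ∨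
      (ε i = 0 ∧ Disjoint (C i) P ∧ Disjoint (C i) N) := by
    intro i
    by_cases h1 : C i ⊆ P
    · exact Or.inl ⟨by simp [hε, h1], h1⟩
    by_cases h2 : C i ⊆ N
    · exact Or.inr (Or.inl ⟨by simp [hε, h1, h2], h2⟩)
    · refine Or.inr (Or.inr ⟨by simp [hε, h1, h2], ?_⟩)
      rcases hCPN i with h | h | h
      · exact absurd h h1
      · exact absurd h h2
      · exact h
  have hsign : ∀ i, ∀ p ∈ C i, ε i ≠ 0 → 0 < (ε i : ℝ) * fderiv ℝ A p (Pi.single 1 1) := by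
    intro i p hp hne
    rcases hε_cases i with ⟨h1, h2⟩ | ⟨h1, h2⟩ | ⟨h1, -, -⟩
    · rw [h1]; have := (h2 hp).2; push_cast; linarith
    · rw [h1]; have := (h2 hp).2; push_cast; linarith
    · exact absurd h1 hne
  have hflat : ∀ i, ∀ p ∈ C i, ε i = 0 → fderiv ℝ A p (Pi.single 1 1) = 0 := by
    intro i p hp h0
    rcases hε_cases i with ⟨h1, -⟩ | ⟨h1, -⟩ | ⟨-, hdP, hdN⟩
    · rw [h0] at h1; exact absurd h1 (by norm_num)
    · rw [h0] at h1; exact absurd h1 (by norm_num)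
    · have hpW := hCW i hp
      by_contra hne
      rcases lt_or_gt_of_ne hne with hlt | hgt
      · exact Set.disjoint_left.1 hdN hp ⟨hpW, hlt⟩
      · exact Set.disjoint_left.1 hdP hp ⟨hpW, hgt⟩
  have hεval : ∀ i, ε i = 1 ∨ ε i = -1 ∨ ε i = 0 := by
    intro i
    rcases hε_cases i with ⟨h, -⟩ | ⟨h, -⟩ | ⟨h, -⟩
    · exact Or.inl h
    · exact Or.inr (Or.inl h)
    · exact Or.inr (Or.inr h)
  -- the strips lie in `[0, 1]`
  have hu : ∀ s : Fin k, 0 ≤ x (Fin.castSucc s) := fun s => by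
    rw [← hx0]; exact hxmono.monotone (Fin.zero_le _)
  have hgraph : ∀ i, ∀ t ∈ Ioo (x (Fin.castSucc (str i))) (x (Fin.succ (str i))),
      (![t, lo i t] : Fin 2 → ℝ) ∈ {p : Fin 2 → ℝ | 0 ≤ p 0 ∧ 0 ≤ p 1 ∧ p 0 + p 1 ≤ 1} ∧
      (![t, hi i t] : Fin 2 → ℝ) ∈ {p : Fin 2 → ℝ | 0 ≤ p 0 ∧ 0 ≤ p 1 ∧ p 0 + p 1 ≤ 1} := fun i =>
    trace_mem_closedTriangle (hu (str i)) (h15 i) (by rw [← h18 i]; exact h21 i)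
  -- differentiability on the cells
  have hAd : ∀ i, DifferentiableOn ℝ A (C i) := fun i => (hA1.mono (hCW i)).differentiableOn one_ne_zero
  have hBd : ∀ i, DifferentiableOn ℝ B (C i) := fun i => (hB1.mono (hCW i)).differentiableOn one_ne_zero
  -- the representations
  have hρlo : ∀ i, ∃ ρ : KZ.IntegralRep 1,
      ρ.domain = {z : Fin 1 → ℝ | z 0 ∈ Set.Ioo (x (Fin.castSucc (str i))) (x (Fin.succ (str i)))} ∧
      ∀ z ∈ ρ.domain, ρ.integrand z = A ![z 0, lo i (z 0)] :=
    fun i => stub_signedSweep_traceRep hA hAc (h16 i) fun t ht => (hgraph i t ht).1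
  choose ρlo hρlo1 hρlo2 using hρlo
  have hρhi : ∀ i, ∃ ρ : KZ.IntegralRep 1,
      ρ.domain = {z : Fin 1 → ℝ | z 0 ∈ Set.Ioo (x (Fin.castSucc (str i))) (x (Fin.succ (str i)))} ∧
      ∀ z ∈ ρ.domain, ρ.integrand z = A ![z 0, hi i (z 0)] :=
    fun i => stub_signedSweep_traceRep hA hAc (h17 i) fun t ht => (hgraph i t ht).2
  choose ρhi hρhi1 hρhi2 using hρhi
  have hCΔ : ∀ i, C i ⊆ {p : Fin 2 → ℝ | 0 ≤ p 0 ∧ 0 ≤ p 1 ∧ p 0 + p 1 ≤ 1} :=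
    fun i => (h21 i).trans openTriangle_subset_closedTriangle
  have hr₁ : ∀ i, ∃ r : KZ.IntegralRep 2, r.domain = (fun p : Fin 2 → ℝ => (![p 0, A p] : Fin 2 → ℝ)) '' C i ∧
      r.integrand = fun _ => 1 := fun i => exists_imageRep hA hAc 0 (h20 i) (hCΔ i)
  choose r₁ hr₁1 hr₁2 using hr₁
  have hr₂ : ∀ i, ∃ r : KZ.IntegralRep 2, r.domain = (fun p : Fin 2 → ℝ => (![p 1, B p] : Fin 2 → ℝ)) '' C i ∧
      r.integrand = fun _ => 1 := fun i => exists_imageRep hB hBc 1 (h20 i) (hCΔ i)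
  choose r₂ hr₂1 hr₂2 using hr₂
  refine ⟨k, x, m, str, lev, L, lo, hi, ε, C, ρlo, ρhi, r₁, r₂, hxmono, hx0, hxl, h4, h5, h6, h7, h8, h9, h10,
    h11, h12, h13, h14, h15, h16, h17, h18, h19, h20, h21, h22, h23, fun i => hA1.mono (hCW i),
    fun i => hB1.mono (hCW i), fun i p hp => hClair p (hCW i hp), hεval, hsign, hflat, ?_, ?_,
    hρlo1, hρhi1, hρlo2, hρhi2, hr₁1, hr₂1, hr₁2, hr₂2⟩
  · -- injectivity of `p ↦ (p 0, A p)` on the signed cells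
    intro i hne
    have hopen := h19 i
    have hdiff := hAd i
    have hpos : ∀ p ∈ C i, 0 < (ε i : ℝ) * fderiv ℝ A p (Pi.single 1 1) := fun p hp => hsign i p hp hne
    rw [h18 i] at hopen hdiff hpos ⊢
    exact stub_signedSweep_injOnShear hopen hdiff hpos cell_update_one_mem
  · -- injectivity of `p ↦ (p 1, B p)` on the signed cells
    intro i hne
    have hopen := h19 i
    have hdiff := hBd i
    have hpos : ∀ p ∈ C i, 0 < (ε i : ℝ) * fderiv ℝ B p (Pi.single 0 1) := fun p hp => by
      rw [← hClair p (hCW i hp)]; exact hsign i p hp hne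
    rw [h18 i] at hopen hdiff hpos ⊢
    exact injOn_shear_snd hopen hdiff hpos (cell_update_zero_mem (h13 i) (h14 i))

end Summit.KontsevichZagierPeriods.SymplecticScissors.PlanarCompilerProof
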